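import Summits.QuantumFields.YangMills.Theorems.UnitScaleTiltProp7PV3EOfPinnedSliceAndZetaRow
import Summits.QuantumFields.YangMills.Theorems.UnitScaleTiltProp7CovConstraintSplitOfRegPr
import Summits.QuantumFields.YangMills.Theorems.UnitScaleTiltProp7CovLaplaceSpectralSplit
import HarnessLib

/-!
# Route `UnitScaleTilt`, crux K1 child «MinimiserStabilityRegPr» (stmt-QuantumFields-19200) — route-R E′, growth side, ROW (S3):
# R5 = THE K-FORM ENGINE ASSEMBLY DOOR.  (S3) «the curved ζ-row on exactly `S_H`-gauged fibre points» (second displayed row of ✓`Prop7PV3EOfPinnedSliceAndZetaRow`)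
# ⇐ THREE BOOKED ENGINE ROWS (H) (P) (B) read on a co-closed covariant Hodge split of the chart, with `L`-only constants and the two bookkeeping inequalities for `ζ`, `δ₁`

Cell `ym3-torus` ∕ fleet seat `ym-ust-19200-p1` (gen 16, route-R E′ lead ∕ namer; DESIGN-S3-KFORM-ENGINE-g15 §R5 «assembly = p1 lineage, door-first»).  THEOREMS ONLY
(0 `def`, 0 `sorry`); `--supports stmt-QuantumFields-19200`, count-neutral.  YM₃ on T³ is a ladder rung (R3), not the Clay problem; nothing here claims the stub, the crux,
d = 4 or the mass gap; (S3) is NOT closed by this file — its three rows are DISPLAYED.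

WHY.  After the ORBIT TEST the growth side of E′ is `(E1) ∧ (S3)` (✓p666280).  (S3) reads, for the chart `D = −i log(YW⁻¹)` of an exactly `S_H`-gauged fibre point `Y` of an
R2-critical `W ∈ (6)(e) ∩ 𝔅_k(V)`:  `DIV_W(D) ≤ ζ·K_W(D) + δ₁·ℓ⁻²·M(D)`, `ℓ = L^{K−n}`.  The K-FORM ENGINE (RULING g28-№2: no potential is ever booked by an ABSOLUTE value —
currencies (K) `K_W`, (Kg)∕(Kg′) commutator energies converted ONCE by the displayed hKg-rows at criticality, (eM) `e·ℓ⁻²·M`, and ONE pure mass term with a FREE coefficient `θ`)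
produces it from the covariant Hodge split `D = B + D_Wφ₀`, `D*_WB = 0` (R0, ✓`Prop7CovHodgeSplit.exists_covHodgeSplit_T3`, consumed INSIDE this door) through three rows,
each the BOOKED form of a located supplier chain:
* (H) LEMMA-H-CURVED booked — `Σ_x|Δ_Wφ₀|²_HS ≤ C_H·ℓ⁻¹·Σ_c|δ^V_c φ₀|²_HS + ζ_H·K + θ_H·e·ℓ⁻²·M` with `δ^V_c φ₀ = φ₀(c₋) − W̄(c)φ₀(c₊)W̄(c)^*`, `W̄ = ` the `(K−n)`-fold (0.4)-average of `W`
  (inhabitant: ✓`Prop7LemmaHCurvedDirichletCount.lemmaH_curved_offset_avg_count` (routeR-w1, assembly (α)) + the junction of its `G`-group with `δ^V` + the displayed rows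
  hKg′-K₁ (its averaged-path Dirichlet family against `K`) and hRes (its Laplacian group, (J2) lettering `J = Q_W^*λ` at criticality));
* (P) the covariant face-flux ∕ Poincaré row booked — `Σ_c|δ^V_c φ₀|²_HS ≤ ℓ·(ζ_P∕θ)·K + θ·ℓ⁻¹·M + θ_P·e·ℓ⁻¹·M + C_P·ℓ·G_W(B) + C_Λ·ℓ·CURL_HS(B)`
  (inhabitant: ✓`Prop7CovFaceFluxRow.sum_normSq_centreDiff_le_of_rows` (px17, R3′ door) over ✓`Prop7CovConstraintSplitOfRegPr.covConstraintSplit_coclosed_T3` (w4, R2′: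
  identity + `Σ_y‖Λ y‖² ≤ ℓ(200L⁴·CURL_HS(B) + 4·10⁹L⁹·e·ℓ⁻²Σ‖B‖²)`), ✓p669695 (T-F), BLOCK-GAUSS (px17, GO 23:01Z), the Gauss pieces Σ₁ (commutator-Stokes, hKg′-K₂ at
  criticality, θ-AM–GM — the ONLY source of the free-`θ` mass term), `J_VH`, `Def` ((eM)), and the linearisation DEFECT of the exact fibre point `Σ_c‖Q_W^{(K−n)}(D)(c)‖² ≤ θ_q·ℓ⁻¹·M`
  (second order in the sup chart));
* (B) the co-closed part's energies — `G_W(B) + CURL_HS(B) ≤ ζ_B·K + θ_B·e·ℓ⁻²·M` (inhabitant: Weitzenböck ✓`Prop7CovIterLambdaHLambdaBridge.sum_normSq_covGrad_le_curl_divB`,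
  ✓`Prop7CovConstraintSplitOfRegPr.sum_hs_divB_eq_zero_of_coclosed`, ✓`Prop7PlaquetteCurlComparison.curlHS_le_plaqK`, ✓`Prop7PlaqKSlowFastKnit.plaqK_sub_le`, the displayed
  hKg-K at `IsCritR2 W` (✓`Prop7PlaqKSlowFastKnit.hKgK_of_hKgK_slow_T3` reduces it to R1-SLOW), and the Hodge Pythagoras `Σ‖B‖² ≤ 2M`).
The door's own content: (i) R0 is consumed by name and the divergence reading `DIV_W(D) = Σ_x|Δ_Wφ₀(x)|²_HS` is PROVED (linearity of `D*_W`, `D*_WB = 0`); (ii) the real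
bookkeeping `DIV ≤ [C_Hζ_P∕θ + ζ_H + C_H(C_P + C_Λ)ζ_B]·K + [C_Hθ + e·(C_Hθ_P + θ_H + C_H(C_P + C_Λ)θ_B)]·ℓ⁻²M`, so that ANY `ζ ≥ C_Hζ_P∕θ + ζ_H + C_H(C_P+C_Λ)ζ_B` and
`δ₁ ≥ C_Hθ + e₆·(C_Hθ_P + θ_H + C_H(C_P+C_Λ)θ_B)` inhabit (S3) — the final E′ assembler meets ✓p666280's window `δ₁ < 4κ_H(L)` by choosing `θ` (then `e₆`).

WHAT IS PROVED (ns `…Theorems.Prop7ZetaRowOfEngineRows`): ★`div_chart_eq_covLap_of_split` (the R0 reading, pointwise), ★`zeta_real` (the bookkeeping),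
★★★ `zetaRow_of_engineRows` ((S3) of ✓p666280 VERBATIM ⇐ rows (H) (P) (B) + the two constant inequalities),
★★★ `stub_PV3E_of_pinnedSliceAndEngineRows` (E′ ⇐ (E1) ∧ (H) (P) (B): ✓p666280 composed with R5 — the kernel's check that the letters are verbatim).
HONEST SCOPE.  Bookkeeping over one landed theorem (R0); rows (H) (P) (B) are DISPLAYED, not proved; hKg-K ∕ hKg′-K₁ ∕ hKg′-K₂ ∕ hRes inside them are inhabited NUMERICALLY only
(NUMERICS-19200-S3-CURVED-g15: `C_g ≈ 0.06–0.11` at constrained critical points, `ζ_SH ≤ 0.2`, `κ_K ≥ 7`); no constant of Bałaban's is asserted.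

References: T. Bałaban, CMP 102 (1985) 277–309 [Balaban1985Variational] ((4)–(7) p.278, (116) p.295, (141)–(143), Prop. 7 p.299); CMP 99 (1985) 389–434
[Balaban1985BackgroundPropagators] ((3.3)–(3.4) pp.390–391, (3.8)–(3.11) p.392, (3.117)–(3.122) pp.419–420, Thm 3.11 p.416); CMP 95 (1984) 17–40 [Balaban1984PropagatorsI]
((1.18)–(1.21) pp.19–21, Prop. 1.1 (1.90) p.33); CMP 98 (1985) 17–51 [Balaban1985Averaging] ((9)–(13) pp.18–19).
-/

set_option autoImplicit false
noncomputable section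

open scoped BigOperators Matrix.Norms.L2Operator Matrix

namespace Summit.QuantumFields.YangMills.Theorems.Prop7ZetaRowOfEngineRows

open Literature.MathematicalPhysics.QuantumFieldTheory.Balaban1983to89
open Literature.MathematicalPhysics.QuantumFieldTheory.Balaban1983to89.T3ContinuumYM3Torus
open Literature.MathematicalPhysics.QuantumFieldTheory.Balaban1983to89.T3Thm1Carrier
open Literature.MathematicalPhysics.QuantumFieldTheory.Balaban1983to89.T3PrintedRegularMinimiser
open Literature.MathematicalPhysics.QuantumFieldTheory.Balaban1983to89.T3RegularMinimiser
open Literature.MathematicalPhysics.QuantumFieldTheory.Balaban1983to89.T3Thm1CarrierNative (IsCritR2)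
open Literature.MathematicalPhysics.QuantumFieldTheory.Balaban1983to89.T3SectALandauChart (CloseAvg)
open T4Continuum BlockAveraging AveragingRT ExpMeanLog
open MatrixLog (mlog)
open B9Eq39Adjoint (R covD covDstar divB curl)
open B10Eq27TorusAxialLog (unitsField toUField)
open B9TorusCalculus (torusT)
open B15DeterminingSets (embIter)
open Summit.QuantumFields.YangMills.Theorems.Prop7CovHodgeSplit (exists_covHodgeSplit_T3)
open Summit.QuantumFields.YangMills.Theorems.Prop7CovLaplaceSpectralSplit (divB_add divB_smul)
open Summit.QuantumFields.YangMills.Theorems.Prop7PV3EOfPinnedSliceAndZetaRow (stub_PV3E_of_pinnedSliceAndZetaRow)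

/-! ## §1 The R0 reading `D*_W(iD) = i·Δ_Wφ₀` (linearity of `D*_W`: ✓`Prop7CovLaplaceSpectralSplit.divB_add∕divB_smul`) -/

section Linear

variable {P : Params} {i : ℕ} {N : ℕ} (U : Fin P.d → Site P i → (Matrix (Fin N) (Fin N) ℂ)ˣ)

/-- ★ **THE R0 READING, POINTWISE.**  For a co-closed covariant Hodge split `D = B + D_Uφ₀`, `D*_U B = 0`:  `D*_U(i·D)(x) = i·(D*_U D_U φ₀)(x)`.
[cite: Balaban1984PropagatorsI, (1.21) p.21; Balaban1985BackgroundPropagators, (3.8) p.392] -/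
theorem div_chart_eq_covLap_of_split (D B : PBond P i → Matrix (Fin N) (Fin N) ℂ) (φ₀ : Site P i → Matrix (Fin N) (Fin N) ℂ)
    (hsplit : ∀ b : PBond P i, D b = B b + covD (torusT P i) U b.dir φ₀ b.src)
    (hB : ∀ x : Site P i, divB (torusT P i) U (fun κ z => B ⟨z, κ⟩) x = 0) (x : Site P i) :
    divB (torusT P i) U (fun κ z => Complex.I • D ⟨z, κ⟩) x
      = Complex.I • divB (torusT P i) U (fun κ y => covD (torusT P i) U κ φ₀ y) x := by
  have h1 : (fun κ (z : Site P i) => Complex.I • D ⟨z, κ⟩)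
      = fun κ z => Complex.I • (B ⟨z, κ⟩ + covD (torusT P i) U κ φ₀ z) := by
    funext κ z; rw [hsplit ⟨z, κ⟩]
  rw [h1, divB_smul]
  congr 1
  rw [divB_add U (fun κ z => B ⟨z, κ⟩) (fun κ z => covD (torusT P i) U κ φ₀ z) x, hB x, zero_add]

/-- `Σ_{j,k}‖(i·X)_{jk}‖² = Σ_{j,k}|X_{jk}|²`. [folklore] -/
theorem sum_norm_sq_I_smul (X : Matrix (Fin N) (Fin N) ℂ) :
    ∑ j : Fin N, ∑ k : Fin N, ‖(Complex.I • X) j k‖ ^ 2 = ∑ j : Fin N, ∑ k : Fin N, Complex.normSq (X j k) := by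
  refine Finset.sum_congr rfl fun j _ => Finset.sum_congr rfl fun k _ => ?_
  rw [Matrix.smul_apply, smul_eq_mul, norm_mul, Complex.norm_I, one_mul, Complex.normSq_eq_norm_sq]

end Linear

/-! ## §2 The real bookkeeping -/

/-- ★ **THE ENGINE's REAL BOOKKEEPING.**  From (A) `DIV ≤ DIVφ`, (H) `DIVφ ≤ C_H·ℓ⁻¹·δV + ζ_H·K + θ_H·e·ℓ⁻²M`,
(P) `δV ≤ ℓ(ζ_P∕θ)K + θℓ⁻¹M + θ_P·e·ℓ⁻¹M + C_P·ℓ·GB + C_Λ·ℓ·CB`, (B) `GB + CB ≤ ζ_B·K + θ_B·e·ℓ⁻²M` and the two constant inequalities: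
`DIV ≤ ζ·K + δ₁·ℓ⁻²·M`. [cite: Balaban1985Variational, Prop. 7 p.299, (141)-(143)] -/
theorem zeta_real {ℓ e e₆ θ C_H ζ_H θ_H ζ_P θ_P C_P C_Λ ζ_B θ_B ζ δ₁ DIV DIVφ δV K M GB CB : ℝ}
    (hℓ : 0 < ℓ) (he : e ≤ e₆) (hθ : 0 < θ) (hCH : 0 ≤ C_H) (hθH : 0 ≤ θ_H) (hθP : 0 ≤ θ_P) (hCP : 0 ≤ C_P) (hCΛ : 0 ≤ C_Λ)
    (hθB : 0 ≤ θ_B) (hK : 0 ≤ K) (hM : 0 ≤ M) (hGB : 0 ≤ GB) (hCB : 0 ≤ CB)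
    (hA : DIV ≤ DIVφ) (hH : DIVφ ≤ C_H * ℓ⁻¹ * δV + ζ_H * K + θ_H * e * (ℓ ^ 2)⁻¹ * M)
    (hP : δV ≤ ℓ * (ζ_P / θ) * K + θ * ℓ⁻¹ * M + θ_P * e * ℓ⁻¹ * M + C_P * ℓ * GB + C_Λ * ℓ * CB)
    (hBr : GB + CB ≤ ζ_B * K + θ_B * e * (ℓ ^ 2)⁻¹ * M)
    (hζ : C_H * ζ_P / θ + ζ_H + C_H * (C_P + C_Λ) * ζ_B ≤ ζ) (hδ : C_H * θ + e₆ * (C_H * θ_P + θ_H + C_H * (C_P + C_Λ) * θ_B) ≤ δ₁) :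
    DIV ≤ ζ * K + δ₁ * (ℓ ^ 2)⁻¹ * M := by
  have hℓ0 : ℓ ≠ 0 := hℓ.ne'
  have hθ0 : θ ≠ 0 := hθ.ne'
  have hu : 0 ≤ (ℓ ^ 2)⁻¹ := by positivity
  have hli : 0 ≤ ℓ⁻¹ := by positivity
  -- (H) after (P), multiplied out
  have h1 : C_H * ℓ⁻¹ * δV ≤ C_H * ℓ⁻¹ * (ℓ * (ζ_P / θ) * K + θ * ℓ⁻¹ * M + θ_P * e * ℓ⁻¹ * M + C_P * ℓ * GB + C_Λ * ℓ * CB) :=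
    mul_le_mul_of_nonneg_left hP (mul_nonneg hCH hli)
  have h1e : C_H * ℓ⁻¹ * (ℓ * (ζ_P / θ) * K + θ * ℓ⁻¹ * M + θ_P * e * ℓ⁻¹ * M + C_P * ℓ * GB + C_Λ * ℓ * CB)
      = C_H * ζ_P / θ * K + C_H * θ * (ℓ ^ 2)⁻¹ * M + C_H * θ_P * e * (ℓ ^ 2)⁻¹ * M + C_H * C_P * GB + C_H * C_Λ * CB := by
    field_simp
  -- the co-closed part
  have h2 : C_H * C_P * GB + C_H * C_Λ * CB ≤ C_H * (C_P + C_Λ) * (GB + CB) := by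
    nlinarith [mul_nonneg hCH (mul_nonneg hCP hCB), mul_nonneg hCH (mul_nonneg hCΛ hGB)]
  have h3 : C_H * (C_P + C_Λ) * (GB + CB) ≤ C_H * (C_P + C_Λ) * (ζ_B * K + θ_B * e * (ℓ ^ 2)⁻¹ * M) :=
    mul_le_mul_of_nonneg_left hBr (mul_nonneg hCH (add_nonneg hCP hCΛ))
  -- collect
  have hKc : (C_H * ζ_P / θ + ζ_H + C_H * (C_P + C_Λ) * ζ_B) * K ≤ ζ * K := mul_le_mul_of_nonneg_right hζ hK
  have hX : 0 ≤ C_H * θ_P + θ_H + C_H * (C_P + C_Λ) * θ_B := by positivity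
  have hMc : (C_H * θ + e * (C_H * θ_P + θ_H + C_H * (C_P + C_Λ) * θ_B)) * ((ℓ ^ 2)⁻¹ * M) ≤ δ₁ * ((ℓ ^ 2)⁻¹ * M) := by
    refine mul_le_mul_of_nonneg_right ?_ (mul_nonneg hu hM)
    calc C_H * θ + e * (C_H * θ_P + θ_H + C_H * (C_P + C_Λ) * θ_B)
        ≤ C_H * θ + e₆ * (C_H * θ_P + θ_H + C_H * (C_P + C_Λ) * θ_B) := by nlinarith
      _ ≤ δ₁ := hδ
  calc DIV ≤ DIVφ := hA
    _ ≤ C_H * ℓ⁻¹ * δV + ζ_H * K + θ_H * e * (ℓ ^ 2)⁻¹ * M := hH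
    _ ≤ (C_H * ζ_P / θ * K + C_H * θ * (ℓ ^ 2)⁻¹ * M + C_H * θ_P * e * (ℓ ^ 2)⁻¹ * M + C_H * (C_P + C_Λ) * (ζ_B * K + θ_B * e * (ℓ ^ 2)⁻¹ * M))
          + ζ_H * K + θ_H * e * (ℓ ^ 2)⁻¹ * M := by linarith [h1, h1e, h2, h3]
    _ = (C_H * ζ_P / θ + ζ_H + C_H * (C_P + C_Λ) * ζ_B) * K
          + (C_H * θ + e * (C_H * θ_P + θ_H + C_H * (C_P + C_Λ) * θ_B)) * ((ℓ ^ 2)⁻¹ * M) := by ring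
    _ ≤ ζ * K + δ₁ * ((ℓ ^ 2)⁻¹ * M) := add_le_add hKc hMc
    _ = ζ * K + δ₁ * (ℓ ^ 2)⁻¹ * M := by ring

/-! ## §3 ★★★ The door: (S3) from the three booked engine rows -/

set_option maxHeartbeats 800000 in
/-- ★★★ **R5 — (S3) ⇐ THE BOOKED ENGINE ROWS (H) (P) (B).**  For `L > 1` and reals `e₆ sQ ζ δ₁`: if there are constants `C_H ζ_H θ_H ζ_P θ θ_P C_P C_Λ ζ_B θ_B` with
`0 ≤ C_H, θ_H, θ_P, C_P, C_Λ, θ_B`, `0 < θ`, `C_Hζ_P∕θ + ζ_H + C_H(C_P + C_Λ)ζ_B ≤ ζ`, `C_Hθ + e₆(C_Hθ_P + θ_H + C_H(C_P + C_Λ)θ_B) ≤ δ₁`, such that at every member, radius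
`0 < e ≤ e₆`, datum `V`, R2-critical `W ∈ (6)(e) ∩ 𝔅_k(V)`, exactly `S_H`-gauged fibre point `Y ∈ (6)(e) ∩ 𝔅_k(V)` with the sup chart `sQℓ⁻¹`, chart `D = −i log(YW⁻¹)` and EVERY
co-closed covariant Hodge split `D = B + D_Wφ₀` the rows (H) (P) (B) hold (letters: `DIV(φ₀) = Σ_x|D*_W D_Wφ₀|²_HS`, `δ^V(φ₀) = Σ_c|φ₀(c₋) − W̄(c)φ₀(c₊)W̄(c)^*|²_HS` over the
`(K−n)`-bonds with `W̄ = ` the `(K−n)`-fold (0.4)-average of `W`, `G_W(B)` = the covariant gradient energy of ✓`sum_normSq_covGrad_le_curl_divB`, `CURL_HS(B)` its curl energy,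
`K`, `M` the door's four-term `ℒ_p` energy and bond mass of `D`), THEN the (S3) conjunct of ✓`Prop7PV3EOfPinnedSliceAndZetaRow.stub_PV3E_of_pinnedSliceAndZetaRow` holds VERBATIM
with these `e₆ sQ ζ δ₁`. [cite: Balaban1985Variational, (141)-(143) p.299, Prop. 7 p.299, (116) p.295; Balaban1985BackgroundPropagators, (3.3)-(3.4) pp.390-391, (3.8)-(3.11) p.392, Thm 3.11 p.416; Balaban1984PropagatorsI, (1.21) p.21, Prop. 1.1 (1.90) p.33] -/
theorem zetaRow_of_engineRows (L : ℕ) (hL : 1 < L) (e₆ sQ ζ δ₁ : ℝ)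
    (hrows : ∃ C_H ζ_H θ_H ζ_P θ θ_P C_P C_Λ ζ_B θ_B : ℝ, 0 ≤ C_H ∧ 0 ≤ θ_H ∧ 0 < θ ∧ 0 ≤ θ_P ∧ 0 ≤ C_P ∧ 0 ≤ C_Λ ∧ 0 ≤ θ_B ∧
      C_H * ζ_P / θ + ζ_H + C_H * (C_P + C_Λ) * ζ_B ≤ ζ ∧ C_H * θ + e₆ * (C_H * θ_P + θ_H + C_H * (C_P + C_Λ) * θ_B) ≤ δ₁ ∧
      ∀ (F : T3Family), F.L = L → ∀ (n K : ℕ) (hnK : n < K) (e : ℝ) (V : GaugeField (F.P n) 0 (Matrix.specialUnitaryGroup (Fin 2) ℂ))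
        (W : GaugeField (F.P K) 0 (Matrix.specialUnitaryGroup (Fin 2) ℂ)),
        0 < e → e ≤ e₆ → W ∈ regFibrePr F n K hnK.le e V → IsCritR2 F n K hnK.le V W →
        ∀ Y : GaugeField (F.P K) 0 (Matrix.specialUnitaryGroup (Fin 2) ℂ), Y ∈ regFibrePr F n K hnK.le e V →
          (∀ b : PBond (F.P K) 0, ‖((Y b * (W b)⁻¹ : Matrix.specialUnitaryGroup (Fin 2) ℂ) : Matrix (Fin 2) (Fin 2) ℂ) - 1‖
              ≤ sQ * ((F.L : ℝ) ^ (K - n))⁻¹) →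
          (∀ x : Site (F.P K) 0, x ∉ Set.range (embIter (K - n)) →
              divB (torusT (F.P K) 0) (fun κ z => unitsField (toUField W) ⟨z, κ⟩)
                (fun μ z => covD (torusT (F.P K) 0) (fun κ z => unitsField (toUField W) ⟨z, κ⟩) μ
                  (fun y => divB (torusT (F.P K) 0) (fun κ z => unitsField (toUField W) ⟨z, κ⟩)
                    (fun κ z => Complex.I • ((-Complex.I) • mlog ((Y ⟨z, κ⟩ * (W ⟨z, κ⟩)⁻¹ : Matrix.specialUnitaryGroup (Fin 2) ℂ) : Matrix (Fin 2) (Fin 2) ℂ))) y) z) x = 0) →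
          ∀ D : PBond (F.P K) 0 → Matrix (Fin 2) (Fin 2) ℂ,
            D = (fun b => (-Complex.I) • mlog ((Y b * (W b)⁻¹ : Matrix.specialUnitaryGroup (Fin 2) ℂ) : Matrix (Fin 2) (Fin 2) ℂ)) →
          -- R0: any co-closed covariant Hodge split `D = B + D_Wφ₀`, `D*_W B = 0` (✓`Prop7CovHodgeSplit.exists_covHodgeSplit_T3` supplies one)
          ∀ (B : PBond (F.P K) 0 → Matrix (Fin 2) (Fin 2) ℂ) (φ₀ : Site (F.P K) 0 → Matrix (Fin 2) (Fin 2) ℂ),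
            (∀ b : PBond (F.P K) 0, D b = B b + covD (torusT (F.P K) 0) (fun κ z => unitsField (toUField W) ⟨z, κ⟩) b.dir φ₀ b.src) →
            (∀ x : Site (F.P K) 0, divB (torusT (F.P K) 0) (fun κ z => unitsField (toUField W) ⟨z, κ⟩) (fun κ z => B ⟨z, κ⟩) x = 0) →
            -- ROW (H): LEMMA-H-CURVED BOOKED (R4 = ✓p666125∕✓p675776 + the junction `G ↔ δ^V` + hKg′-K₁ + hRes): `DIV(φ₀) ≤ C_H·ℓ⁻¹·δ^V(φ₀) + ζ_H·K + θ_H·e·ℓ⁻²·M`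
            (∑ x : Site (F.P K) 0, ∑ a : Fin 2, ∑ b : Fin 2,
                Complex.normSq ((divB (torusT (F.P K) 0) (fun κ z => unitsField (toUField W) ⟨z, κ⟩)
                  (fun κ y => covD (torusT (F.P K) 0) (fun κ z => unitsField (toUField W) ⟨z, κ⟩) κ φ₀ y) x) a b))
              ≤ C_H * ((F.L : ℝ) ^ (K - n))⁻¹ * (∑ c : PBond (F.P K) (K - n), ∑ a : Fin 2, ∑ b : Fin 2,
                Complex.normSq ((φ₀ (embIter (K - n) c.src) - ((Averaging.iter (fun i => blockAvg (P := F.P K) (j := i) (expMeanLogSU (n := Fin 2))) (K - n) W c : Matrix.specialUnitaryGroup (Fin 2) ℂ) : Matrix (Fin 2) (Fin 2) ℂ)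
                    * φ₀ (embIter (K - n) c.tgt) * star ((Averaging.iter (fun i => blockAvg (P := F.P K) (j := i) (expMeanLogSU (n := Fin 2))) (K - n) W c : Matrix.specialUnitaryGroup (Fin 2) ℂ) : Matrix (Fin 2) (Fin 2) ℂ)) a b))
                + ζ_H * (∑ p : Plaq (F.P K) 0, ‖((Complex.I • D ⟨p.src, p.μ⟩) + ((W ⟨p.src, p.μ⟩ : Matrix (Fin 2) (Fin 2) ℂ) * (Complex.I • D ⟨p.src.shift p.μ, p.ν⟩) * star (W ⟨p.src, p.μ⟩ : Matrix (Fin 2) (Fin 2) ℂ))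
            - (((W ⟨p.src, p.μ⟩ * W ⟨p.src.shift p.μ, p.ν⟩ * (W ⟨p.src.shift p.ν, p.μ⟩)⁻¹ : Matrix.specialUnitaryGroup (Fin 2) ℂ) : Matrix (Fin 2) (Fin 2) ℂ) * (Complex.I • D ⟨p.src.shift p.ν, p.μ⟩) * star ((W ⟨p.src, p.μ⟩ * W ⟨p.src.shift p.μ, p.ν⟩ * (W ⟨p.src.shift p.ν, p.μ⟩)⁻¹ : Matrix.specialUnitaryGroup (Fin 2) ℂ) : Matrix (Fin 2) (Fin 2) ℂ))
            - (((GaugeField.plaqHol W p : Matrix.specialUnitaryGroup (Fin 2) ℂ) : Matrix (Fin 2) (Fin 2) ℂ) * (Complex.I • D ⟨p.src, p.ν⟩) * star ((GaugeField.plaqHol W p : Matrix.specialUnitaryGroup (Fin 2) ℂ) : Matrix (Fin 2) (Fin 2) ℂ)))‖ ^ 2)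
                + θ_H * e * (((F.L : ℝ) ^ (K - n)) ^ 2)⁻¹ * (∑ b : PBond (F.P K) 0, ‖D b‖ ^ 2) ∧
            -- ROW (P): THE COVARIANT FACE-FLUX ∕ POINCARÉ ROW BOOKED (R3′ = ✓p669468 + hX pieces + hKg′-K₂ + J_VH + Def + defect + R2′ ✓p666871): free `θ` on the pure mass term
            (∑ c : PBond (F.P K) (K - n), ∑ a : Fin 2, ∑ b : Fin 2,
                Complex.normSq ((φ₀ (embIter (K - n) c.src) - ((Averaging.iter (fun i => blockAvg (P := F.P K) (j := i) (expMeanLogSU (n := Fin 2))) (K - n) W c : Matrix.specialUnitaryGroup (Fin 2) ℂ) : Matrix (Fin 2) (Fin 2) ℂ)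
                    * φ₀ (embIter (K - n) c.tgt) * star ((Averaging.iter (fun i => blockAvg (P := F.P K) (j := i) (expMeanLogSU (n := Fin 2))) (K - n) W c : Matrix.specialUnitaryGroup (Fin 2) ℂ) : Matrix (Fin 2) (Fin 2) ℂ)) a b))
              ≤ ((F.L : ℝ) ^ (K - n)) * (ζ_P / θ) * (∑ p : Plaq (F.P K) 0, ‖((Complex.I • D ⟨p.src, p.μ⟩) + ((W ⟨p.src, p.μ⟩ : Matrix (Fin 2) (Fin 2) ℂ) * (Complex.I • D ⟨p.src.shift p.μ, p.ν⟩) * star (W ⟨p.src, p.μ⟩ : Matrix (Fin 2) (Fin 2) ℂ))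
            - (((W ⟨p.src, p.μ⟩ * W ⟨p.src.shift p.μ, p.ν⟩ * (W ⟨p.src.shift p.ν, p.μ⟩)⁻¹ : Matrix.specialUnitaryGroup (Fin 2) ℂ) : Matrix (Fin 2) (Fin 2) ℂ) * (Complex.I • D ⟨p.src.shift p.ν, p.μ⟩) * star ((W ⟨p.src, p.μ⟩ * W ⟨p.src.shift p.μ, p.ν⟩ * (W ⟨p.src.shift p.ν, p.μ⟩)⁻¹ : Matrix.specialUnitaryGroup (Fin 2) ℂ) : Matrix (Fin 2) (Fin 2) ℂ))
            - (((GaugeField.plaqHol W p : Matrix.specialUnitaryGroup (Fin 2) ℂ) : Matrix (Fin 2) (Fin 2) ℂ) * (Complex.I • D ⟨p.src, p.ν⟩) * star ((GaugeField.plaqHol W p : Matrix.specialUnitaryGroup (Fin 2) ℂ) : Matrix (Fin 2) (Fin 2) ℂ)))‖ ^ 2)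
                + θ * ((F.L : ℝ) ^ (K - n))⁻¹ * (∑ b : PBond (F.P K) 0, ‖D b‖ ^ 2)
                + θ_P * e * ((F.L : ℝ) ^ (K - n))⁻¹ * (∑ b : PBond (F.P K) 0, ‖D b‖ ^ 2)
                + C_P * ((F.L : ℝ) ^ (K - n)) * (∑ b : PBond (F.P K) 0, ∑ ν : Fin (F.P K).d,
                ‖((W ⟨b.src, ν⟩ : Matrix.specialUnitaryGroup (Fin 2) ℂ) : Matrix (Fin 2) (Fin 2) ℂ) * B ⟨b.src.shift ν, b.dir⟩ * star ((W ⟨b.src, ν⟩ : Matrix.specialUnitaryGroup (Fin 2) ℂ) : Matrix (Fin 2) (Fin 2) ℂ) - B b‖ ^ 2)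
                + C_Λ * ((F.L : ℝ) ^ (K - n)) * (∑ x : Site (F.P K) 0, ∑ μ : Fin (F.P K).d, ∑ ν : Fin (F.P K).d,
                (if μ < ν then ∑ j : Fin 2, ∑ k : Fin 2, ‖(curl (torusT (F.P K) 0) (fun κ z => unitsField (toUField W) ⟨z, κ⟩) (fun κ z => B ⟨z, κ⟩) μ ν x) j k‖ ^ 2 else 0)) ∧
            -- ROW (B): THE CO-CLOSED PART's ENERGIES IN K-CURRENCY (Weitzenböck ✓ + ✓`curlHS_le_plaqK` + ✓`plaqK_sub_le` + hKg-K at `IsCritR2 W` + Pythagoras)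
            (∑ b : PBond (F.P K) 0, ∑ ν : Fin (F.P K).d,
                ‖((W ⟨b.src, ν⟩ : Matrix.specialUnitaryGroup (Fin 2) ℂ) : Matrix (Fin 2) (Fin 2) ℂ) * B ⟨b.src.shift ν, b.dir⟩ * star ((W ⟨b.src, ν⟩ : Matrix.specialUnitaryGroup (Fin 2) ℂ) : Matrix (Fin 2) (Fin 2) ℂ) - B b‖ ^ 2)
                + (∑ x : Site (F.P K) 0, ∑ μ : Fin (F.P K).d, ∑ ν : Fin (F.P K).d,
                (if μ < ν then ∑ j : Fin 2, ∑ k : Fin 2, ‖(curl (torusT (F.P K) 0) (fun κ z => unitsField (toUField W) ⟨z, κ⟩) (fun κ z => B ⟨z, κ⟩) μ ν x) j k‖ ^ 2 else 0))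
              ≤ ζ_B * (∑ p : Plaq (F.P K) 0, ‖((Complex.I • D ⟨p.src, p.μ⟩) + ((W ⟨p.src, p.μ⟩ : Matrix (Fin 2) (Fin 2) ℂ) * (Complex.I • D ⟨p.src.shift p.μ, p.ν⟩) * star (W ⟨p.src, p.μ⟩ : Matrix (Fin 2) (Fin 2) ℂ))
            - (((W ⟨p.src, p.μ⟩ * W ⟨p.src.shift p.μ, p.ν⟩ * (W ⟨p.src.shift p.ν, p.μ⟩)⁻¹ : Matrix.specialUnitaryGroup (Fin 2) ℂ) : Matrix (Fin 2) (Fin 2) ℂ) * (Complex.I • D ⟨p.src.shift p.ν, p.μ⟩) * star ((W ⟨p.src, p.μ⟩ * W ⟨p.src.shift p.μ, p.ν⟩ * (W ⟨p.src.shift p.ν, p.μ⟩)⁻¹ : Matrix.specialUnitaryGroup (Fin 2) ℂ) : Matrix (Fin 2) (Fin 2) ℂ))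
            - (((GaugeField.plaqHol W p : Matrix.specialUnitaryGroup (Fin 2) ℂ) : Matrix (Fin 2) (Fin 2) ℂ) * (Complex.I • D ⟨p.src, p.ν⟩) * star ((GaugeField.plaqHol W p : Matrix.specialUnitaryGroup (Fin 2) ℂ) : Matrix (Fin 2) (Fin 2) ℂ)))‖ ^ 2)
                + θ_B * e * (((F.L : ℝ) ^ (K - n)) ^ 2)⁻¹ * (∑ b : PBond (F.P K) 0, ‖D b‖ ^ 2)) :
    ∀ (F : T3Family), F.L = L → ∀ (n K : ℕ) (hnK : n < K) (e : ℝ) (V : GaugeField (F.P n) 0 (Matrix.specialUnitaryGroup (Fin 2) ℂ))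
        (W : GaugeField (F.P K) 0 (Matrix.specialUnitaryGroup (Fin 2) ℂ)),
        0 < e → e ≤ e₆ → W ∈ regFibrePr F n K hnK.le e V → IsCritR2 F n K hnK.le V W →
        ∀ Y : GaugeField (F.P K) 0 (Matrix.specialUnitaryGroup (Fin 2) ℂ), Y ∈ regFibrePr F n K hnK.le e V →
          (∀ b : PBond (F.P K) 0, ‖((Y b * (W b)⁻¹ : Matrix.specialUnitaryGroup (Fin 2) ℂ) : Matrix (Fin 2) (Fin 2) ℂ) - 1‖
              ≤ sQ * ((F.L : ℝ) ^ (K - n))⁻¹) →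
          (∀ x : Site (F.P K) 0, x ∉ Set.range (embIter (K - n)) →
              divB (torusT (F.P K) 0) (fun κ z => unitsField (toUField W) ⟨z, κ⟩)
                (fun μ z => covD (torusT (F.P K) 0) (fun κ z => unitsField (toUField W) ⟨z, κ⟩) μ
                  (fun y => divB (torusT (F.P K) 0) (fun κ z => unitsField (toUField W) ⟨z, κ⟩)
                    (fun κ z => Complex.I • ((-Complex.I) • mlog ((Y ⟨z, κ⟩ * (W ⟨z, κ⟩)⁻¹ : Matrix.specialUnitaryGroup (Fin 2) ℂ) : Matrix (Fin 2) (Fin 2) ℂ))) y) z) x = 0) →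
          ∀ D : PBond (F.P K) 0 → Matrix (Fin 2) (Fin 2) ℂ,
            D = (fun b => (-Complex.I) • mlog ((Y b * (W b)⁻¹ : Matrix.specialUnitaryGroup (Fin 2) ℂ) : Matrix (Fin 2) (Fin 2) ℂ)) →
            (∑ x : Site (F.P K) 0, ∑ j : Fin 2, ∑ k : Fin 2,
              ‖(divB (torusT (F.P K) 0) (fun κ z => unitsField (toUField W) ⟨z, κ⟩) (fun κ z => Complex.I • D ⟨z, κ⟩) x) j k‖ ^ 2)
              ≤ ζ * (∑ p : Plaq (F.P K) 0, ‖((Complex.I • D ⟨p.src, p.μ⟩) + ((W ⟨p.src, p.μ⟩ : Matrix (Fin 2) (Fin 2) ℂ) * (Complex.I • D ⟨p.src.shift p.μ, p.ν⟩) * star (W ⟨p.src, p.μ⟩ : Matrix (Fin 2) (Fin 2) ℂ))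
            - (((W ⟨p.src, p.μ⟩ * W ⟨p.src.shift p.μ, p.ν⟩ * (W ⟨p.src.shift p.ν, p.μ⟩)⁻¹ : Matrix.specialUnitaryGroup (Fin 2) ℂ) : Matrix (Fin 2) (Fin 2) ℂ) * (Complex.I • D ⟨p.src.shift p.ν, p.μ⟩) * star ((W ⟨p.src, p.μ⟩ * W ⟨p.src.shift p.μ, p.ν⟩ * (W ⟨p.src.shift p.ν, p.μ⟩)⁻¹ : Matrix.specialUnitaryGroup (Fin 2) ℂ) : Matrix (Fin 2) (Fin 2) ℂ))
            - (((GaugeField.plaqHol W p : Matrix.specialUnitaryGroup (Fin 2) ℂ) : Matrix (Fin 2) (Fin 2) ℂ) * (Complex.I • D ⟨p.src, p.ν⟩) * star ((GaugeField.plaqHol W p : Matrix.specialUnitaryGroup (Fin 2) ℂ) : Matrix (Fin 2) (Fin 2) ℂ)))‖ ^ 2)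
                + δ₁ * (((F.L : ℝ) ^ (K - n)) ^ 2)⁻¹ * (∑ b : PBond (F.P K) 0, ‖D b‖ ^ 2) := by
  obtain ⟨C_H, ζ_H, θ_H, ζ_P, θ, θ_P, C_P, C_Λ, ζ_B, θ_B, hCH, hθH, hθ, hθP, hCP, hCΛ, hθB, hζ, hδ, H⟩ := hrows
  intro F hF n K hnK e V W he hhe hW hWcrit Y hY hsup hSH D hD
  -- R0: the co-closed covariant Hodge split of the chart (✓`exists_covHodgeSplit_T3`)
  obtain ⟨φ₀, hcoc, -⟩ := exists_covHodgeSplit_T3 F K W D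
  set B : PBond (F.P K) 0 → Matrix (Fin 2) (Fin 2) ℂ := fun b => D b - covD (torusT (F.P K) 0) (fun κ z => unitsField (toUField W) ⟨z, κ⟩) b.dir φ₀ b.src with hBdef
  have hsplit : ∀ b : PBond (F.P K) 0, D b = B b + covD (torusT (F.P K) 0) (fun κ z => unitsField (toUField W) ⟨z, κ⟩) b.dir φ₀ b.src := fun b => by
    simp only [hBdef, sub_add_cancel]
  have hBc : ∀ x : Site (F.P K) 0, divB (torusT (F.P K) 0) (fun κ z => unitsField (toUField W) ⟨z, κ⟩) (fun κ z => B ⟨z, κ⟩) x = 0 := fun x => by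
    simpa only [hBdef] using hcoc x
  obtain ⟨hHrow, hProw, hBrow⟩ := H F hF n K hnK e V W he hhe hW hWcrit Y hY hsup hSH D hD B φ₀ hsplit hBc
  -- (A) the divergence reading `DIV(D) = DIV(φ₀)`
  have hA : (∑ x : Site (F.P K) 0, ∑ j : Fin 2, ∑ k : Fin 2,
              ‖(divB (torusT (F.P K) 0) (fun κ z => unitsField (toUField W) ⟨z, κ⟩) (fun κ z => Complex.I • D ⟨z, κ⟩) x) j k‖ ^ 2)
      = (∑ x : Site (F.P K) 0, ∑ a : Fin 2, ∑ b : Fin 2,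
                Complex.normSq ((divB (torusT (F.P K) 0) (fun κ z => unitsField (toUField W) ⟨z, κ⟩)
                  (fun κ y => covD (torusT (F.P K) 0) (fun κ z => unitsField (toUField W) ⟨z, κ⟩) κ φ₀ y) x) a b)) := by
    refine Finset.sum_congr rfl fun x _ => ?_
    rw [div_chart_eq_covLap_of_split (fun κ z => unitsField (toUField W) ⟨z, κ⟩) D B φ₀ hsplit hBc x, sum_norm_sq_I_smul]
  have hFL : (F.L : ℝ) = (L : ℝ) := by exact_mod_cast hF
  have hL1 : (1 : ℝ) < (F.L : ℝ) := by rw [hFL]; exact_mod_cast hL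
  have hℓ : (0 : ℝ) < ((F.L : ℝ) ^ (K - n)) := by positivity
  have hK0 : 0 ≤ (∑ p : Plaq (F.P K) 0, ‖((Complex.I • D ⟨p.src, p.μ⟩) + ((W ⟨p.src, p.μ⟩ : Matrix (Fin 2) (Fin 2) ℂ) * (Complex.I • D ⟨p.src.shift p.μ, p.ν⟩) * star (W ⟨p.src, p.μ⟩ : Matrix (Fin 2) (Fin 2) ℂ))
            - (((W ⟨p.src, p.μ⟩ * W ⟨p.src.shift p.μ, p.ν⟩ * (W ⟨p.src.shift p.ν, p.μ⟩)⁻¹ : Matrix.specialUnitaryGroup (Fin 2) ℂ) : Matrix (Fin 2) (Fin 2) ℂ) * (Complex.I • D ⟨p.src.shift p.ν, p.μ⟩) * star ((W ⟨p.src, p.μ⟩ * W ⟨p.src.shift p.μ, p.ν⟩ * (W ⟨p.src.shift p.ν, p.μ⟩)⁻¹ : Matrix.specialUnitaryGroup (Fin 2) ℂ) : Matrix (Fin 2) (Fin 2) ℂ))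
            - (((GaugeField.plaqHol W p : Matrix.specialUnitaryGroup (Fin 2) ℂ) : Matrix (Fin 2) (Fin 2) ℂ) * (Complex.I • D ⟨p.src, p.ν⟩) * star ((GaugeField.plaqHol W p : Matrix.specialUnitaryGroup (Fin 2) ℂ) : Matrix (Fin 2) (Fin 2) ℂ)))‖ ^ 2) := Finset.sum_nonneg fun _ _ => sq_nonneg _
  have hM0 : 0 ≤ (∑ b : PBond (F.P K) 0, ‖D b‖ ^ 2) := Finset.sum_nonneg fun _ _ => sq_nonneg _
  have hGB0 : 0 ≤ (∑ b : PBond (F.P K) 0, ∑ ν : Fin (F.P K).d,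
                ‖((W ⟨b.src, ν⟩ : Matrix.specialUnitaryGroup (Fin 2) ℂ) : Matrix (Fin 2) (Fin 2) ℂ) * B ⟨b.src.shift ν, b.dir⟩ * star ((W ⟨b.src, ν⟩ : Matrix.specialUnitaryGroup (Fin 2) ℂ) : Matrix (Fin 2) (Fin 2) ℂ) - B b‖ ^ 2) := Finset.sum_nonneg fun _ _ => Finset.sum_nonneg fun _ _ => sq_nonneg _
  have hCB0 : 0 ≤ (∑ x : Site (F.P K) 0, ∑ μ : Fin (F.P K).d, ∑ ν : Fin (F.P K).d,
                (if μ < ν then ∑ j : Fin 2, ∑ k : Fin 2, ‖(curl (torusT (F.P K) 0) (fun κ z => unitsField (toUField W) ⟨z, κ⟩) (fun κ z => B ⟨z, κ⟩) μ ν x) j k‖ ^ 2 else 0)) := by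
    refine Finset.sum_nonneg fun _ _ => Finset.sum_nonneg fun _ _ => Finset.sum_nonneg fun _ _ => ?_
    split_ifs
    · exact Finset.sum_nonneg fun _ _ => Finset.sum_nonneg fun _ _ => sq_nonneg _
    · exact le_rfl
  exact zeta_real hℓ hhe hθ hCH hθH hθP hCP hCΛ hθB hK0 hM0 hGB0 hCB0 hA.le hHrow hProw hBrow hζ hδ

set_option maxHeartbeats 800000 in
/-- ★★★ **E′ ⇐ (E1) ∧ THE BOOKED ENGINE ROWS (H) (P) (B)** — ✓`stub_PV3E_of_pinnedSliceAndZetaRow` with its (S3) conjunct DISCHARGED by ✓`zetaRow_of_engineRows`: the route-R E′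
display after R5.  Per `L > 1`: the constants `e₆ sQ ζ δ₁` with the windows of ✓p666280 VERBATIM, the pinned slice theorem (E1) VERBATIM, and the engine constants
`C_H ζ_H θ_H ζ_P θ θ_P C_P C_Λ ζ_B θ_B` with `C_Hζ_P∕θ + ζ_H + C_H(C_P + C_Λ)ζ_B ≤ ζ`, `C_Hθ + e₆(C_Hθ_P + θ_H + C_H(C_P + C_Λ)θ_B) ≤ δ₁` and the rows (H) (P) (B).
CONCLUSION = the E′ text verbatim. [cite: Balaban1985Variational, (141)-(143) p.299, Prop. 7 p.299, (4)-(7) p.278, (116) p.295; Balaban1985BackgroundPropagators, (3.8)-(3.11) p.392, Thm 3.11 p.416; Balaban1985RegularSpaces, (1.14) p.78, Thm 2 p.83] -/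
theorem stub_PV3E_of_pinnedSliceAndEngineRows
    (hrows : ∀ (L : ℕ), 1 < L → ∃ e₆ sQ ζ δ₁ : ℝ, 0 < e₆ ∧ 100000000000000 * (L : ℝ) ^ 9 * e₆ ≤ 1 ∧ 0 ≤ sQ ∧ 8 * sQ ≤ 1 ∧
      800000000000 * (L : ℝ) ^ 9 * sQ ≤ 1 ∧ 0 ≤ ζ ∧ 0 ≤ δ₁ ∧ δ₁ < 4 * (1 / (128 * (18 + 537600 * (L : ℝ) ^ 4))) ∧
      16 * e₆ * ((8 * ((3 / 2) * (694800 * (L : ℝ) ^ 5) * (28800 * (L : ℝ) ^ 4) * ((L : ℝ) ^ 2 / ((L : ℝ) ^ 3 - 1)))) * (1 + ζ)) ≤ 1 ∧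
      15552 * (2 * sQ) ^ 2 + 216 * e₆ + 2 * e₆ * ((2 * ((3 / 2) * (694800 * (L : ℝ) ^ 5) * (7 * ((L : ℝ) ^ 2 / ((L : ℝ) - 1)) + 600000 * (L : ℝ) ^ 4 * ((L : ℝ) ^ 2 / ((L : ℝ) ^ 3 - 1)))) + 322608 * ((3 / 2) * (694800 * (L : ℝ) ^ 5) * (28800 * (L : ℝ) ^ 4) * ((L : ℝ) ^ 2 / ((L : ℝ) ^ 3 - 1))))
        + (8 * ((3 / 2) * (694800 * (L : ℝ) ^ 5) * (28800 * (L : ℝ) ^ 4) * ((L : ℝ) ^ 2 / ((L : ℝ) ^ 3 - 1)))) * δ₁)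
        ≤ (((1 / (128 * (18 + 537600 * (L : ℝ) ^ 4))) - δ₁ / 4) / (1 + ζ / 4)) / 8 ∧
      -- (E1) the pinned slice theorem: an exactly S_H-gauged fibre point per competitor
      (∀ (F : T3Family), F.L = L → ∀ (n K : ℕ) (hnK : n < K) (e : ℝ) (V : GaugeField (F.P n) 0 (Matrix.specialUnitaryGroup (Fin 2) ℂ))
        (W : GaugeField (F.P K) 0 (Matrix.specialUnitaryGroup (Fin 2) ℂ)),
        0 < e → e ≤ e₆ → W ∈ regFibrePr F n K hnK.le e V → IsCritR2 F n K hnK.le V W →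
        ∀ W' : GaugeField (F.P K) 0 (Matrix.specialUnitaryGroup (Fin 2) ℂ), W' ∈ regFibrePr F n K hnK.le e V →
          ∃ Y : GaugeField (F.P K) 0 (Matrix.specialUnitaryGroup (Fin 2) ℂ), Y ∈ regFibrePr F n K hnK.le e V ∧ wilsonAction4 W' = wilsonAction4 Y ∧
            (∀ b : PBond (F.P K) 0, ‖((Y b * (W b)⁻¹ : Matrix.specialUnitaryGroup (Fin 2) ℂ) : Matrix (Fin 2) (Fin 2) ℂ) - 1‖
              ≤ sQ * ((F.L : ℝ) ^ (K - n))⁻¹) ∧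
            (∀ x : Site (F.P K) 0, x ∉ Set.range (embIter (K - n)) →
              divB (torusT (F.P K) 0) (fun κ z => unitsField (toUField W) ⟨z, κ⟩)
                (fun μ z => covD (torusT (F.P K) 0) (fun κ z => unitsField (toUField W) ⟨z, κ⟩) μ
                  (fun y => divB (torusT (F.P K) 0) (fun κ z => unitsField (toUField W) ⟨z, κ⟩)
                    (fun κ z => Complex.I • ((-Complex.I) • mlog ((Y ⟨z, κ⟩ * (W ⟨z, κ⟩)⁻¹ : Matrix.specialUnitaryGroup (Fin 2) ℂ) : Matrix (Fin 2) (Fin 2) ℂ))) y) z) x = 0)) ∧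
      -- (S3) REPLACED BY THE BOOKED ENGINE ROWS of ✓`zetaRow_of_engineRows`
      (∃ C_H ζ_H θ_H ζ_P θ θ_P C_P C_Λ ζ_B θ_B : ℝ, 0 ≤ C_H ∧ 0 ≤ θ_H ∧ 0 < θ ∧ 0 ≤ θ_P ∧ 0 ≤ C_P ∧ 0 ≤ C_Λ ∧ 0 ≤ θ_B ∧
      C_H * ζ_P / θ + ζ_H + C_H * (C_P + C_Λ) * ζ_B ≤ ζ ∧ C_H * θ + e₆ * (C_H * θ_P + θ_H + C_H * (C_P + C_Λ) * θ_B) ≤ δ₁ ∧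
      ∀ (F : T3Family), F.L = L → ∀ (n K : ℕ) (hnK : n < K) (e : ℝ) (V : GaugeField (F.P n) 0 (Matrix.specialUnitaryGroup (Fin 2) ℂ))
        (W : GaugeField (F.P K) 0 (Matrix.specialUnitaryGroup (Fin 2) ℂ)),
        0 < e → e ≤ e₆ → W ∈ regFibrePr F n K hnK.le e V → IsCritR2 F n K hnK.le V W →
        ∀ Y : GaugeField (F.P K) 0 (Matrix.specialUnitaryGroup (Fin 2) ℂ), Y ∈ regFibrePr F n K hnK.le e V →
          (∀ b : PBond (F.P K) 0, ‖((Y b * (W b)⁻¹ : Matrix.specialUnitaryGroup (Fin 2) ℂ) : Matrix (Fin 2) (Fin 2) ℂ) - 1‖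
              ≤ sQ * ((F.L : ℝ) ^ (K - n))⁻¹) →
          (∀ x : Site (F.P K) 0, x ∉ Set.range (embIter (K - n)) →
              divB (torusT (F.P K) 0) (fun κ z => unitsField (toUField W) ⟨z, κ⟩)
                (fun μ z => covD (torusT (F.P K) 0) (fun κ z => unitsField (toUField W) ⟨z, κ⟩) μ
                  (fun y => divB (torusT (F.P K) 0) (fun κ z => unitsField (toUField W) ⟨z, κ⟩)
                    (fun κ z => Complex.I • ((-Complex.I) • mlog ((Y ⟨z, κ⟩ * (W ⟨z, κ⟩)⁻¹ : Matrix.specialUnitaryGroup (Fin 2) ℂ) : Matrix (Fin 2) (Fin 2) ℂ))) y) z) x = 0) →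
          ∀ D : PBond (F.P K) 0 → Matrix (Fin 2) (Fin 2) ℂ,
            D = (fun b => (-Complex.I) • mlog ((Y b * (W b)⁻¹ : Matrix.specialUnitaryGroup (Fin 2) ℂ) : Matrix (Fin 2) (Fin 2) ℂ)) →
          -- R0: any co-closed covariant Hodge split `D = B + D_Wφ₀`, `D*_W B = 0` (✓`Prop7CovHodgeSplit.exists_covHodgeSplit_T3` supplies one)
          ∀ (B : PBond (F.P K) 0 → Matrix (Fin 2) (Fin 2) ℂ) (φ₀ : Site (F.P K) 0 → Matrix (Fin 2) (Fin 2) ℂ),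
            (∀ b : PBond (F.P K) 0, D b = B b + covD (torusT (F.P K) 0) (fun κ z => unitsField (toUField W) ⟨z, κ⟩) b.dir φ₀ b.src) →
            (∀ x : Site (F.P K) 0, divB (torusT (F.P K) 0) (fun κ z => unitsField (toUField W) ⟨z, κ⟩) (fun κ z => B ⟨z, κ⟩) x = 0) →
            -- ROW (H): LEMMA-H-CURVED BOOKED (R4 = ✓p666125∕✓p675776 + the junction `G ↔ δ^V` + hKg′-K₁ + hRes): `DIV(φ₀) ≤ C_H·ℓ⁻¹·δ^V(φ₀) + ζ_H·K + θ_H·e·ℓ⁻²·M`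
            (∑ x : Site (F.P K) 0, ∑ a : Fin 2, ∑ b : Fin 2,
                Complex.normSq ((divB (torusT (F.P K) 0) (fun κ z => unitsField (toUField W) ⟨z, κ⟩)
                  (fun κ y => covD (torusT (F.P K) 0) (fun κ z => unitsField (toUField W) ⟨z, κ⟩) κ φ₀ y) x) a b))
              ≤ C_H * ((F.L : ℝ) ^ (K - n))⁻¹ * (∑ c : PBond (F.P K) (K - n), ∑ a : Fin 2, ∑ b : Fin 2,
                Complex.normSq ((φ₀ (embIter (K - n) c.src) - ((Averaging.iter (fun i => blockAvg (P := F.P K) (j := i) (expMeanLogSU (n := Fin 2))) (K - n) W c : Matrix.specialUnitaryGroup (Fin 2) ℂ) : Matrix (Fin 2) (Fin 2) ℂ)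
                    * φ₀ (embIter (K - n) c.tgt) * star ((Averaging.iter (fun i => blockAvg (P := F.P K) (j := i) (expMeanLogSU (n := Fin 2))) (K - n) W c : Matrix.specialUnitaryGroup (Fin 2) ℂ) : Matrix (Fin 2) (Fin 2) ℂ)) a b))
                + ζ_H * (∑ p : Plaq (F.P K) 0, ‖((Complex.I • D ⟨p.src, p.μ⟩) + ((W ⟨p.src, p.μ⟩ : Matrix (Fin 2) (Fin 2) ℂ) * (Complex.I • D ⟨p.src.shift p.μ, p.ν⟩) * star (W ⟨p.src, p.μ⟩ : Matrix (Fin 2) (Fin 2) ℂ))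
            - (((W ⟨p.src, p.μ⟩ * W ⟨p.src.shift p.μ, p.ν⟩ * (W ⟨p.src.shift p.ν, p.μ⟩)⁻¹ : Matrix.specialUnitaryGroup (Fin 2) ℂ) : Matrix (Fin 2) (Fin 2) ℂ) * (Complex.I • D ⟨p.src.shift p.ν, p.μ⟩) * star ((W ⟨p.src, p.μ⟩ * W ⟨p.src.shift p.μ, p.ν⟩ * (W ⟨p.src.shift p.ν, p.μ⟩)⁻¹ : Matrix.specialUnitaryGroup (Fin 2) ℂ) : Matrix (Fin 2) (Fin 2) ℂ))
            - (((GaugeField.plaqHol W p : Matrix.specialUnitaryGroup (Fin 2) ℂ) : Matrix (Fin 2) (Fin 2) ℂ) * (Complex.I • D ⟨p.src, p.ν⟩) * star ((GaugeField.plaqHol W p : Matrix.specialUnitaryGroup (Fin 2) ℂ) : Matrix (Fin 2) (Fin 2) ℂ)))‖ ^ 2)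
                + θ_H * e * (((F.L : ℝ) ^ (K - n)) ^ 2)⁻¹ * (∑ b : PBond (F.P K) 0, ‖D b‖ ^ 2) ∧
            -- ROW (P): THE COVARIANT FACE-FLUX ∕ POINCARÉ ROW BOOKED (R3′ = ✓p669468 + hX pieces + hKg′-K₂ + J_VH + Def + defect + R2′ ✓p666871): free `θ` on the pure mass term
            (∑ c : PBond (F.P K) (K - n), ∑ a : Fin 2, ∑ b : Fin 2,
                Complex.normSq ((φ₀ (embIter (K - n) c.src) - ((Averaging.iter (fun i => blockAvg (P := F.P K) (j := i) (expMeanLogSU (n := Fin 2))) (K - n) W c : Matrix.specialUnitaryGroup (Fin 2) ℂ) : Matrix (Fin 2) (Fin 2) ℂ)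
                    * φ₀ (embIter (K - n) c.tgt) * star ((Averaging.iter (fun i => blockAvg (P := F.P K) (j := i) (expMeanLogSU (n := Fin 2))) (K - n) W c : Matrix.specialUnitaryGroup (Fin 2) ℂ) : Matrix (Fin 2) (Fin 2) ℂ)) a b))
              ≤ ((F.L : ℝ) ^ (K - n)) * (ζ_P / θ) * (∑ p : Plaq (F.P K) 0, ‖((Complex.I • D ⟨p.src, p.μ⟩) + ((W ⟨p.src, p.μ⟩ : Matrix (Fin 2) (Fin 2) ℂ) * (Complex.I • D ⟨p.src.shift p.μ, p.ν⟩) * star (W ⟨p.src, p.μ⟩ : Matrix (Fin 2) (Fin 2) ℂ))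
            - (((W ⟨p.src, p.μ⟩ * W ⟨p.src.shift p.μ, p.ν⟩ * (W ⟨p.src.shift p.ν, p.μ⟩)⁻¹ : Matrix.specialUnitaryGroup (Fin 2) ℂ) : Matrix (Fin 2) (Fin 2) ℂ) * (Complex.I • D ⟨p.src.shift p.ν, p.μ⟩) * star ((W ⟨p.src, p.μ⟩ * W ⟨p.src.shift p.μ, p.ν⟩ * (W ⟨p.src.shift p.ν, p.μ⟩)⁻¹ : Matrix.specialUnitaryGroup (Fin 2) ℂ) : Matrix (Fin 2) (Fin 2) ℂ))
            - (((GaugeField.plaqHol W p : Matrix.specialUnitaryGroup (Fin 2) ℂ) : Matrix (Fin 2) (Fin 2) ℂ) * (Complex.I • D ⟨p.src, p.ν⟩) * star ((GaugeField.plaqHol W p : Matrix.specialUnitaryGroup (Fin 2) ℂ) : Matrix (Fin 2) (Fin 2) ℂ)))‖ ^ 2)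
                + θ * ((F.L : ℝ) ^ (K - n))⁻¹ * (∑ b : PBond (F.P K) 0, ‖D b‖ ^ 2)
                + θ_P * e * ((F.L : ℝ) ^ (K - n))⁻¹ * (∑ b : PBond (F.P K) 0, ‖D b‖ ^ 2)
                + C_P * ((F.L : ℝ) ^ (K - n)) * (∑ b : PBond (F.P K) 0, ∑ ν : Fin (F.P K).d,
                ‖((W ⟨b.src, ν⟩ : Matrix.specialUnitaryGroup (Fin 2) ℂ) : Matrix (Fin 2) (Fin 2) ℂ) * B ⟨b.src.shift ν, b.dir⟩ * star ((W ⟨b.src, ν⟩ : Matrix.specialUnitaryGroup (Fin 2) ℂ) : Matrix (Fin 2) (Fin 2) ℂ) - B b‖ ^ 2)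
                + C_Λ * ((F.L : ℝ) ^ (K - n)) * (∑ x : Site (F.P K) 0, ∑ μ : Fin (F.P K).d, ∑ ν : Fin (F.P K).d,
                (if μ < ν then ∑ j : Fin 2, ∑ k : Fin 2, ‖(curl (torusT (F.P K) 0) (fun κ z => unitsField (toUField W) ⟨z, κ⟩) (fun κ z => B ⟨z, κ⟩) μ ν x) j k‖ ^ 2 else 0)) ∧
            -- ROW (B): THE CO-CLOSED PART's ENERGIES IN K-CURRENCY (Weitzenböck ✓ + ✓`curlHS_le_plaqK` + ✓`plaqK_sub_le` + hKg-K at `IsCritR2 W` + Pythagoras)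
            (∑ b : PBond (F.P K) 0, ∑ ν : Fin (F.P K).d,
                ‖((W ⟨b.src, ν⟩ : Matrix.specialUnitaryGroup (Fin 2) ℂ) : Matrix (Fin 2) (Fin 2) ℂ) * B ⟨b.src.shift ν, b.dir⟩ * star ((W ⟨b.src, ν⟩ : Matrix.specialUnitaryGroup (Fin 2) ℂ) : Matrix (Fin 2) (Fin 2) ℂ) - B b‖ ^ 2)
                + (∑ x : Site (F.P K) 0, ∑ μ : Fin (F.P K).d, ∑ ν : Fin (F.P K).d,
                (if μ < ν then ∑ j : Fin 2, ∑ k : Fin 2, ‖(curl (torusT (F.P K) 0) (fun κ z => unitsField (toUField W) ⟨z, κ⟩) (fun κ z => B ⟨z, κ⟩) μ ν x) j k‖ ^ 2 else 0))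
              ≤ ζ_B * (∑ p : Plaq (F.P K) 0, ‖((Complex.I • D ⟨p.src, p.μ⟩) + ((W ⟨p.src, p.μ⟩ : Matrix (Fin 2) (Fin 2) ℂ) * (Complex.I • D ⟨p.src.shift p.μ, p.ν⟩) * star (W ⟨p.src, p.μ⟩ : Matrix (Fin 2) (Fin 2) ℂ))
            - (((W ⟨p.src, p.μ⟩ * W ⟨p.src.shift p.μ, p.ν⟩ * (W ⟨p.src.shift p.ν, p.μ⟩)⁻¹ : Matrix.specialUnitaryGroup (Fin 2) ℂ) : Matrix (Fin 2) (Fin 2) ℂ) * (Complex.I • D ⟨p.src.shift p.ν, p.μ⟩) * star ((W ⟨p.src, p.μ⟩ * W ⟨p.src.shift p.μ, p.ν⟩ * (W ⟨p.src.shift p.ν, p.μ⟩)⁻¹ : Matrix.specialUnitaryGroup (Fin 2) ℂ) : Matrix (Fin 2) (Fin 2) ℂ))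
            - (((GaugeField.plaqHol W p : Matrix.specialUnitaryGroup (Fin 2) ℂ) : Matrix (Fin 2) (Fin 2) ℂ) * (Complex.I • D ⟨p.src, p.ν⟩) * star ((GaugeField.plaqHol W p : Matrix.specialUnitaryGroup (Fin 2) ℂ) : Matrix (Fin 2) (Fin 2) ℂ)))‖ ^ 2)
                + θ_B * e * (((F.L : ℝ) ^ (K - n)) ^ 2)⁻¹ * (∑ b : PBond (F.P K) 0, ‖D b‖ ^ 2))) :
    ∀ (L : ℕ), 1 < L → ∀ (B₃ : ℝ), 4 < B₃ →
    ∃ e₅ a₁'' : ℝ, 0 < e₅ ∧ 0 < a₁'' ∧ ∀ (i : Idx L) (e ε₁ : ℝ) (V : GaugeField (i.1.1.P i.1.2.1) 0 (Matrix.specialUnitaryGroup (Fin 2) ℂ))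
      (U₀ W : GaugeField (i.1.1.P i.1.2.2) 0 (Matrix.specialUnitaryGroup (Fin 2) ℂ)),
      0 < ε₁ → ε₁ ≤ a₁'' → PlaqSmall ε₁ V → (L : ℝ) ^ 3 * B₃ * ε₁ ≤ e → e ≤ e₅ →
      RegPr i.1.1 i.1.2.1 i.1.2.2 ((L : ℝ) ^ 3 * B₃ * ε₁) U₀ → CloseAvg i.1.1 i.1.2.1 i.1.2.2 i.2.2.le ((L : ℝ) ^ 3 * ε₁) V U₀ →
      W ∈ regFibrePr i.1.1 i.1.2.1 i.1.2.2 i.2.2.le e V → IsCritR2 i.1.1 i.1.2.1 i.1.2.2 i.2.2.le V W →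
        IsMinOn (fun W' : GaugeField (i.1.1.P i.1.2.2) 0 (Matrix.specialUnitaryGroup (Fin 2) ℂ) => wilsonAction4 W')
          (regFibrePr i.1.1 i.1.2.1 i.1.2.2 i.2.2.le e V) W := by
  refine stub_PV3E_of_pinnedSliceAndZetaRow ?_
  intro L hL
  obtain ⟨e₆, sQ, ζ, δ₁, he₆, he₆L, hsQ0, hsQ8, hsQL, hζ, hδ0, hδκ, hwin1, hwin2, hE1, hEng⟩ := hrows L hL
  exact ⟨e₆, sQ, ζ, δ₁, he₆, he₆L, hsQ0, hsQ8, hsQL, hζ, hδ0, hδκ, hwin1, hwin2, hE1, zetaRow_of_engineRows L hL e₆ sQ ζ δ₁ hEng⟩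

end Summit.QuantumFields.YangMills.Theorems.Prop7ZetaRowOfEngineRows

end
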